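import Summits.Ventures.CertifiedManyBodySolver.Downfold.EmeryAxialOrbitalWeight
import Summits.Ventures.CertifiedManyBodySolver.Downfold.EmeryBilayerMirror
import HarnessLib

/-!
# THE `s`-WEIGHT PROFILE IS NOT `v² = ((cos k_x − cos k_y)/2)²`: on every σ contour `v² = (u − u_node)(u + u_node + fsD/fsN)` (`u = x + y`)
# while the four-orbital Cu-4s weight is `w_s = (4a′γ₁/fsN)·(u − u_node)/W4(u)` — the `v²` heuristic for the bilayer / c-axis splitting
# under-weights the near-nodal arc by the factor `(1 + δ₄)·(1 + (u_an − u_node)/(2u_node + fsD/fsN)) ≥ 1 + δ₄`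

Venture CertifiedManyBodySolver, cell `pub/hubbard-downfold` (stage S1; INFLATION-RULES-3to1-B §B.80 (f)–(h) — the k-PROFILE of the interlayer hopping that the
bilayer boxes' `tperp/t` rows (M257 Hg-1212, M260 Tl-2212, #33 Bi-2212, #18 YBa₂Cu₃O₇) and the S3 c-axis input carry as `t⊥(k) = t⊥·v(k)²`
[AndersenEtAl1995, Eq. (24)]), seat hubbard-downfold-mod-4 (technique B, g32); namespace `Summit.Ventures.CertifiedManyBodySolver.Downfold.Emery`.
Sequel of `EmeryAxialOrbitalWeight` (§B.78: on the four-orbital Fermi surface `w_s = a′·axialLin(t̄)/W4`, fixed-Fermi-surface coordinates),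
`EmeryAxialFermiVelocity` (`fsT·axialLin = γ₀ + 8γ₁s`, `γ₁ > 0`, `harm_sub_node_eq`) and `EmeryBilayerMirror` §6 (the leading-order `v²` dictionary).
Everything PROVED (0 sorry; `ring`/`field_simp`/`linear_combination`). WHAT THIS IS NOT: a statement about any material; `a′ = t_sp²/(ε_s − ε_F)²` is a free
model input; first-order (Hellmann–Feynman) splittings; U = 0 one-body algebra.

* §1 `vsq_halfAngle`: `((cos k_x − cos k_y)/2)² = (x − y)²` in the half-angle variables `x = sin²(k_x/2)`, `y = sin²(k_y/2)`.
* §2 **`v²` ON A σ CONTOUR** (`vsq_on_contour`, `fsN ≠ 0`, `fsN1 ≠ 0`): `(x − y)² = (u − 2x_node)·(u + 2x_node + fsD/fsN)`, `u = x + y` — the contour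
  relation `16fsN·xy = cA − 4fsD·u` makes `v²` a QUADRATIC in `u` whose roots are the node `u = 2x_node` and `−2x_node − fsD/fsN`; so along the Fermi
  surface `v²` is the node-vanishing factor `(u − u_node)` times the INCREASING affine factor `u + u_node + fsD/fsN` (`fsD/fsN = −1/(t′/t) − 2 > 0` in the
  cuprate regime).
* §3 **THE AXIAL NUMERATOR IN NODE FORM** (`axialLin_node_form`, `fsN, fsN1, fsT ≠ 0`): on the contour `axialLin = (4γ₁/fsN)·(u − 2x_node)` — affine in
  `u` with ONE zero, at the node (`γ₁ = axialGamma1 > 0`, `EmeryAxialFermiVelocity.axialGamma1_pos`).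
* §4 **THE PROFILE LAW** (`sWeight4_profile_law`, fixed-Fermi-surface coordinates of `EmeryAxialOrbitalWeight` §3): on the four-orbital Fermi surface
  `w_s(k)·W4(k)·fsN·(u + 2x_node + fsD/fsN) = 4a′γ₁·v(k)²` — the Cu-4s weight (hence the first-order c-axis hopping `t⊥·w_s(k)` of a stack and, up to
  the odd/even level shift in the denominator, the first-order bilayer splitting `2t⊥_ss·w_s(k)` of `EmeryBilayerAxialSplitting`) IS `v²` DIVIDED BY TWO
  AFFINE FUNCTIONS OF `u`: the four-orbital energy denominator `W4 = ∂_ε charCubic + a′·axialLin` and the geometric factor `u + u_node + fsD/fsN`.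
  Two-point form (`profile_ratio_two_point`): for contour points `P, P′` off the node,
  `(w_s(P)/w_s(P′))·(v²(P′)/v²(P)) = [W4(P′)(u′ + u_node + fsD/fsN)]/[W4(P)(u + u_node + fsD/fsN)]`.
* §5 **THE NEAR-NODAL ENHANCEMENT** (`nodalEnhancement`, `nodalEnhancement_eq`, `one_le_geomFactor`): normalising both profiles at the antinode
  `(1, y_a)`, the ratio of the true near-nodal weight to the `v²` prediction is the `u → u_node` value of §4's right side,
  `E = (W4(an)/W4(node))·G`, `G = (u_an + u_node + fsD/fsN)/(2u_node + fsD/fsN) = 1 + (u_an − u_node)/(2u_node + fsD/fsN) ≥ 1` (`u_an ≥ u_node` on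
  every zone contour, `EmeryOrbitalWeightCheck.sum_mem_Icc_xNode_yFace`), and `W4(an)/W4(node) = 1 + δ₄` is the antinodal four-orbital form defect of
  `EmerySecularFormDefectAxial` (certified per typed row in router/EMERY-FORM-DEFECT.tsv): **the `(cos k_x − cos k_y)²` interlayer form factor, scaled to
  the antinodal splitting, UNDER-WEIGHTS the near-nodal splitting by `(1 + δ₄)·G`** — at the [AndersenEtAl1995] four-orbital point `2.5×` (float, cell file
  `bilayer-g32/explore/ex2.py`); census router/VSQ-PROFILE.tsv.
* §6 (appended) **POINTWISE DOMINATION AND THE SLOPE READING**: when `β₄(a′) ≥ 0` (`W4` non-decreasing toward the antinode, i.e. `δ₄ ≥ 0` — every typed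
  row at the located slope) the `v²` form factor scaled to the antinode is a pointwise LOWER bound of `w_s` at every Fermi point (`one_le_profile_ratio`,
  via `W4_le_W4_of_beta4_nonneg`), so every Fermi-surface average built from `t⊥,max·v²` is a lower estimate of the first-order four-orbital value; and ONE
  profile ratio `R` READS the axial slope: `a′·(R·axialLin(P)g(P) − axialLin(P′)g(P′)) = ∂_εcharCubic(P′)g(P′) − R·∂_εcharCubic(P)g(P)`
  (`axialSlope_linear_of_profile_ratio`, `axialSlope_eq_of_profile_ratio`) — the free `a′ = t_sp²/(ε_s − ε_F)²` becomes readable from a bilayer band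
  structure, a c-axis warping profile or projected `s` weights at two Fermi points.

Sources: [AndersenEtAl1995, Eq. (24) (`t⊥(k) ∝ v²`), §6 (the `x, y` contour variables)]; [ChakravartyEtAl1993InterlayerTunneling] is NOT cited (no
claim about mechanisms); [folklore] algebra.
-/

noncomputable section

namespace Summit.Ventures.CertifiedManyBodySolver.Downfold.Emery

open Real Set

/-! ## §1 `v²` in the half-angle variables -/

/-- `((cos k_x − cos k_y)/2)² = (sin²(k_x/2) − sin²(k_y/2))²`. [cite: AndersenEtAl1995, Eq. (24) and §6] -/
theorem vsq_halfAngle (kx ky : ℝ) :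
    ((Real.cos kx - Real.cos ky) / 2) ^ 2 = (Real.sin (kx / 2) ^ 2 - Real.sin (ky / 2) ^ 2) ^ 2 := by
  rw [Literature.Probability.LatticeModels.cos_eq_one_sub_two_mul_sin_half_sq kx,
    Literature.Probability.LatticeModels.cos_eq_one_sub_two_mul_sin_half_sq ky]
  ring

/-! ## §2 `v²` on a σ contour is `(u − u_node)` times an increasing affine factor -/

/-- **`v²` ON THE CONTOUR**: `(x − y)² = (x + y − 2x_node)·(x + y + 2x_node + fsD/fsN)` at every point of the `ε`-contour (`fsN ≠ 0`, `fsN1 ≠ 0`).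
[folklore] -/
theorem vsq_on_contour {Δ tpd tpp c x y ε : ℝ} (hN : fsN tpd tpp c ε ≠ 0) (hN1 : fsN1 tpd tpp c ε ≠ 0)
    (hP : charCubic Δ tpd tpp c x y ε = 0) :
    (x - y) ^ 2 = (x + y - 2 * xNode Δ tpd tpp c ε) * (x + y + 2 * xNode Δ tpd tpp c ε + fsD Δ tpd c ε / fsN tpd tpp c ε) := by
  have h1 := hP
  have h2 := charCubic_xNode (Δ := Δ) hN1
  rw [charCubic_bilinear] at h1 h2
  rw [eq_comm]
  field_simp
  linear_combination (-(1:ℝ) / 4) * h1 + ((1:ℝ) / 4) * h2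

/-- The geometric factor is increasing in `u` (slope 1) and, in the cuprate regime `fsD, fsN > 0`, positive at the node for `x_node ≥ 0`. [folklore] -/
theorem vsq_factor_pos {Δ tpd tpp c ε u : ℝ} (hN : 0 < fsN tpd tpp c ε) (hD : 0 < fsD Δ tpd c ε)
    (hxn : 0 ≤ xNode Δ tpd tpp c ε) (hu : 2 * xNode Δ tpd tpp c ε ≤ u) :
    0 < u + 2 * xNode Δ tpd tpp c ε + fsD Δ tpd c ε / fsN tpd tpp c ε := by
  have : 0 < fsD Δ tpd c ε / fsN tpd tpp c ε := div_pos hD hN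
  linarith

/-! ## §3 The axial numerator in node form -/

/-- **`axialLin = (4γ₁/fsN)·(u − 2x_node)` ON THE CONTOUR** (`fsN, fsN1, fsT ≠ 0`). [folklore] -/
theorem axialLin_node_form {Δ tpd tpp c x y ε : ℝ} (hN : fsN tpd tpp c ε ≠ 0) (hN1 : fsN1 tpd tpp c ε ≠ 0)
    (hT : fsT Δ tpd tpp c ε ≠ 0) (hP : charCubic Δ tpd tpp c x y ε = 0) :
    axialLin Δ tpd tpp c x y ε = 4 * axialGamma1 Δ tpd tpp c ε / fsN tpd tpp c ε * (x + y - 2 * xNode Δ tpd tpp c ε) := by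
  have h2 := fsT_mul_axialLin_sub Δ tpd tpp c x y ε
  rw [hP, mul_zero, sub_zero] at h2
  have hn := axialGamma_node (Δ := Δ) hN1
  have hh := harm_sub_node_eq hN1 hP
  -- `fsT·axialLin = 8γ₁(s − s_node)` and `8fsN(s − s_node) = 4fsT(u − 2x_node)`
  have key : fsN tpd tpp c ε * (fsT Δ tpd tpp c ε * axialLin Δ tpd tpp c x y ε) =
      fsT Δ tpd tpp c ε * (4 * axialGamma1 Δ tpd tpp c ε * (x + y - 2 * xNode Δ tpd tpp c ε)) := by
    linear_combination fsN tpd tpp c ε * h2 + fsN tpd tpp c ε * hn + axialGamma1 Δ tpd tpp c ε * hh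
  have key2 : fsN tpd tpp c ε * axialLin Δ tpd tpp c x y ε = 4 * axialGamma1 Δ tpd tpp c ε * (x + y - 2 * xNode Δ tpd tpp c ε) :=
    mul_left_cancel₀ hT (by linear_combination key)
  rw [eq_comm, div_mul_eq_mul_div, div_eq_iff hN]
  linear_combination -key2

/-! ## §4 The profile law: `w_s` is `v²` over two affine functions of `u` -/

/-- **THE PROFILE LAW** (fixed Fermi surface: frozen couplings `t̄ = (t_pp, t_pp′)`, direct `t̄ − α`, `T = α(ε_s − ε)`, slope `a′ = α/(ε_s − ε)`; contour point
with `fsN, fsN1, fsT ≠ 0`, `W4 ≠ 0`): `w_s·W4·fsN·(u + 2x_node + fsD/fsN) = 4a′γ₁·(x − y)²`. [folklore] -/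
theorem sWeight4_profile_law {Δ εs tpd tpp c α T x y ε : ℝ} (hε : εs - ε ≠ 0) (hTα : T = α * (εs - ε))
    (hP : charCubic Δ tpd tpp c x y ε = 0) (hN : fsN tpd tpp c ε ≠ 0) (hN1 : fsN1 tpd tpp c ε ≠ 0) (hT : fsT Δ tpd tpp c ε ≠ 0)
    (hW4 : W4 Δ tpd tpp c (α / (εs - ε)) x y ε ≠ 0) :
    sWeight4 Δ εs tpd (tpp - α) (c - α) T x y ε * W4 Δ tpd tpp c (α / (εs - ε)) x y ε * fsN tpd tpp c ε *
        (x + y + 2 * xNode Δ tpd tpp c ε + fsD Δ tpd c ε / fsN tpd tpp c ε) =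
      4 * (α / (εs - ε)) * axialGamma1 Δ tpd tpp c ε * (x - y) ^ 2 := by
  rw [sWeight4_fixedFS hε hTα hP, div_mul_cancel₀ _ hW4, vsq_on_contour hN hN1 hP, axialLin_node_form hN hN1 hT hP]
  field_simp

/-- **TWO-POINT FORM**: for two points `P = (x, y)`, `P′ = (x′, y′)` of the same four-orbital Fermi surface, both off the node (`v² ≠ 0`) with non-zero
weights' denominators, `(w_s(P)·v²(P′))·[W4(P)(u + 2x_node + fsD/fsN)] = (w_s(P′)·v²(P))·[W4(P′)(u′ + 2x_node + fsD/fsN)]` — the antinode-normalised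
`w_s` profile over the antinode-normalised `v²` profile is the ratio of the two affine denominators. [folklore] -/
theorem profile_ratio_two_point {Δ εs tpd tpp c α T x y x' y' ε : ℝ} (hε : εs - ε ≠ 0) (hTα : T = α * (εs - ε))
    (hP : charCubic Δ tpd tpp c x y ε = 0) (hP' : charCubic Δ tpd tpp c x' y' ε = 0)
    (hN : fsN tpd tpp c ε ≠ 0) (hN1 : fsN1 tpd tpp c ε ≠ 0) (hT : fsT Δ tpd tpp c ε ≠ 0)
    (hW4 : W4 Δ tpd tpp c (α / (εs - ε)) x y ε ≠ 0) (hW4' : W4 Δ tpd tpp c (α / (εs - ε)) x' y' ε ≠ 0) :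
    sWeight4 Δ εs tpd (tpp - α) (c - α) T x y ε * (x' - y') ^ 2 *
        (W4 Δ tpd tpp c (α / (εs - ε)) x y ε * (x + y + 2 * xNode Δ tpd tpp c ε + fsD Δ tpd c ε / fsN tpd tpp c ε)) =
      sWeight4 Δ εs tpd (tpp - α) (c - α) T x' y' ε * (x - y) ^ 2 *
        (W4 Δ tpd tpp c (α / (εs - ε)) x' y' ε * (x' + y' + 2 * xNode Δ tpd tpp c ε + fsD Δ tpd c ε / fsN tpd tpp c ε)) := by
  have h := sWeight4_profile_law hε hTα hP hN hN1 hT hW4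
  have h' := sWeight4_profile_law hε hTα hP' hN hN1 hT hW4'
  have e : sWeight4 Δ εs tpd (tpp - α) (c - α) T x y ε * (x' - y') ^ 2 *
        (W4 Δ tpd tpp c (α / (εs - ε)) x y ε * (x + y + 2 * xNode Δ tpd tpp c ε + fsD Δ tpd c ε / fsN tpd tpp c ε)) * fsN tpd tpp c ε =
      sWeight4 Δ εs tpd (tpp - α) (c - α) T x' y' ε * (x - y) ^ 2 *
        (W4 Δ tpd tpp c (α / (εs - ε)) x' y' ε * (x' + y' + 2 * xNode Δ tpd tpp c ε + fsD Δ tpd c ε / fsN tpd tpp c ε)) * fsN tpd tpp c ε := by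
    linear_combination (x' - y') ^ 2 * h - (x - y) ^ 2 * h'
  exact mul_right_cancel₀ hN e

/-! ## §5 The near-nodal enhancement: `(1 + δ₄)·G`, `G ≥ 1` -/

/-- The geometric factor `G = (u_an + 2x_node + fsD/fsN)/(4x_node + fsD/fsN)` of the antinodal point `u_an = 1 + y_a` relative to the node. [folklore] -/
def geomFactor (Δ tpd tpp c ya ε : ℝ) : ℝ :=
  (1 + ya + 2 * xNode Δ tpd tpp c ε + fsD Δ tpd c ε / fsN tpd tpp c ε) / (4 * xNode Δ tpd tpp c ε + fsD Δ tpd c ε / fsN tpd tpp c ε)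

/-- `G = 1 + (u_an − u_node)/(2u_node + fsD/fsN)` (denominator `≠ 0`). [folklore] -/
theorem geomFactor_eq {Δ tpd tpp c ya ε : ℝ} (hd : 4 * xNode Δ tpd tpp c ε + fsD Δ tpd c ε / fsN tpd tpp c ε ≠ 0) :
    geomFactor Δ tpd tpp c ya ε =
      1 + (1 + ya - 2 * xNode Δ tpd tpp c ε) / (4 * xNode Δ tpd tpp c ε + fsD Δ tpd c ε / fsN tpd tpp c ε) := by
  rw [geomFactor, one_add_div hd]
  congr 1
  ring

/-- **`G ≥ 1`** whenever the antinodal `u` is at least the nodal one (`1 + y_a ≥ 2x_node`: every zone contour, `sum_mem_Icc_xNode_yFace`) and the nodal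
denominator is positive (cuprate regime). [folklore] -/
theorem one_le_geomFactor {Δ tpd tpp c ya ε : ℝ} (hd : 0 < 4 * xNode Δ tpd tpp c ε + fsD Δ tpd c ε / fsN tpd tpp c ε)
    (hu : 2 * xNode Δ tpd tpp c ε ≤ 1 + ya) : 1 ≤ geomFactor Δ tpd tpp c ya ε := by
  rw [geomFactor_eq hd.ne']
  have : 0 ≤ (1 + ya - 2 * xNode Δ tpd tpp c ε) / (4 * xNode Δ tpd tpp c ε + fsD Δ tpd c ε / fsN tpd tpp c ε) :=
    div_nonneg (by linarith) hd.le
  linarith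

/-- `G ≥ 1` on every zone contour in the cuprate regime (`fsN, fsD > 0`, `ε ≥ 0`, `fsN1 > 0`), for the antinodal ordinate `y_a = yFace` with `(1, y_a)`
on the contour inside the zone. [folklore] -/
theorem one_le_geomFactor_yFace {Δ tpd tpp c ε : ℝ} (hN : 0 < fsN tpd tpp c ε) (hD : 0 < fsD Δ tpd c ε) (hε : 0 ≤ ε)
    (hN1 : 0 < fsN1 tpd tpp c ε) (hxn : 0 ≤ xNode Δ tpd tpp c ε) (hya : yFace Δ tpd tpp c ε ∈ Icc (0 : ℝ) 1)
    (hPa : charCubic Δ tpd tpp c 1 (yFace Δ tpd tpp c ε) ε = 0) :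
    1 ≤ geomFactor Δ tpd tpp c (yFace Δ tpd tpp c ε) ε := by
  have hs := (sum_mem_Icc_xNode_yFace hN hD hε hN1.ne' ⟨zero_le_one, le_refl 1⟩ hya hPa).1
  apply one_le_geomFactor
  · have : 0 < fsD Δ tpd c ε / fsN tpd tpp c ε := div_pos hD hN
    linarith
  · linarith

/-- THE NEAR-NODAL ENHANCEMENT `E(a′) := (W4 a′(an)/W4 a′(node))·G` — the `u → u_node` value of the two-point profile ratio with `P′` the antinode:
by how much the `v²` form factor, scaled to the antinodal weight, under-estimates the near-nodal Cu-4s weight (first-order c-axis / bilayer splitting).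
[folklore] -/
def nodalEnhancement (Δ tpd tpp c a' ya ε : ℝ) : ℝ :=
  W4 Δ tpd tpp c a' 1 ya ε / W4 Δ tpd tpp c a' (xNode Δ tpd tpp c ε) (xNode Δ tpd tpp c ε) ε * geomFactor Δ tpd tpp c ya ε

/-- `E = (1 + δ₄)·G` with `1 + δ₄ = W4(an)/W4(node) = ∂_εcharCubic(an)/∂_εcharCubic(node) + a′·axialLin(an)/∂_εcharCubic(node)`
(`EmerySecularFormDefectAxial.formDefect4_linear`; `fsN1 ≠ 0`, `∂_εcharCubic(node) ≠ 0`). [folklore] -/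
theorem nodalEnhancement_eq {Δ tpd tpp c ya ε : ℝ} (a' : ℝ) (hN1 : fsN1 tpd tpp c ε ≠ 0)
    (hWn : dcharCubic Δ tpd tpp c (xNode Δ tpd tpp c ε) (xNode Δ tpd tpp c ε) ε ≠ 0) :
    nodalEnhancement Δ tpd tpp c a' ya ε =
      (dcharCubic Δ tpd tpp c 1 ya ε / dcharCubic Δ tpd tpp c (xNode Δ tpd tpp c ε) (xNode Δ tpd tpp c ε) ε
        + a' * (axialLin Δ tpd tpp c 1 ya ε / dcharCubic Δ tpd tpp c (xNode Δ tpd tpp c ε) (xNode Δ tpd tpp c ε) ε))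
        * geomFactor Δ tpd tpp c ya ε := by
  rw [nodalEnhancement, formDefect4_linear a' hWn (axialLin_xNode hN1)]

/-- **`E ≥ 1 + δ₄ ≥ 1`**: with `W4(an) ≥ W4(node) > 0` (non-negative antinodal form defect) and `G ≥ 1`, the enhancement is at least the form-defect
factor. [folklore] -/
theorem formDefect_le_nodalEnhancement {Δ tpd tpp c a' ya ε : ℝ}
    (hWn : 0 < W4 Δ tpd tpp c a' (xNode Δ tpd tpp c ε) (xNode Δ tpd tpp c ε) ε)
    (hWa : W4 Δ tpd tpp c a' (xNode Δ tpd tpp c ε) (xNode Δ tpd tpp c ε) ε ≤ W4 Δ tpd tpp c a' 1 ya ε)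
    (hG : 1 ≤ geomFactor Δ tpd tpp c ya ε) :
    W4 Δ tpd tpp c a' 1 ya ε / W4 Δ tpd tpp c a' (xNode Δ tpd tpp c ε) (xNode Δ tpd tpp c ε) ε ≤ nodalEnhancement Δ tpd tpp c a' ya ε ∧
      1 ≤ nodalEnhancement Δ tpd tpp c a' ya ε := by
  have h1 : 1 ≤ W4 Δ tpd tpp c a' 1 ya ε / W4 Δ tpd tpp c a' (xNode Δ tpd tpp c ε) (xNode Δ tpd tpp c ε) ε := by
    rw [le_div_iff₀ hWn]; linarith
  unfold nodalEnhancement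
  constructor
  · nlinarith
  · nlinarith

/-- **DIVISION FORM OF THE TWO-POINT LAW**: `(w_s(P)/v²(P)) / (w_s(P′)/v²(P′)) = [W4(P′)(u′ + 2x_node + fsD/fsN)] / [W4(P)(u + 2x_node + fsD/fsN)]`
for two Fermi-surface points off the node (`v² ≠ 0`, `w_s(P′) ≠ 0`, denominators `≠ 0`): the `w_s`-to-`v²` ratio along the surface is the reciprocal of
the product of the two affine denominators — its value with `P` at the node and `P′` at the antinode is `nodalEnhancement` (`nodalEnhancement_eq_ratio`).
[folklore] -/
theorem profile_ratio_div {Δ εs tpd tpp c α T x y x' y' ε : ℝ} (hε : εs - ε ≠ 0) (hTα : T = α * (εs - ε))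
    (hP : charCubic Δ tpd tpp c x y ε = 0) (hP' : charCubic Δ tpd tpp c x' y' ε = 0)
    (hN : fsN tpd tpp c ε ≠ 0) (hN1 : fsN1 tpd tpp c ε ≠ 0) (hT : fsT Δ tpd tpp c ε ≠ 0)
    (hW4 : W4 Δ tpd tpp c (α / (εs - ε)) x y ε ≠ 0) (hW4' : W4 Δ tpd tpp c (α / (εs - ε)) x' y' ε ≠ 0)
    (hv : (x - y) ^ 2 ≠ 0) (hw' : sWeight4 Δ εs tpd (tpp - α) (c - α) T x' y' ε ≠ 0)
    (hden : W4 Δ tpd tpp c (α / (εs - ε)) x y ε * (x + y + 2 * xNode Δ tpd tpp c ε + fsD Δ tpd c ε / fsN tpd tpp c ε) ≠ 0) :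
    (sWeight4 Δ εs tpd (tpp - α) (c - α) T x y ε / (x - y) ^ 2) / (sWeight4 Δ εs tpd (tpp - α) (c - α) T x' y' ε / (x' - y') ^ 2) =
      (W4 Δ tpd tpp c (α / (εs - ε)) x' y' ε * (x' + y' + 2 * xNode Δ tpd tpp c ε + fsD Δ tpd c ε / fsN tpd tpp c ε)) /
        (W4 Δ tpd tpp c (α / (εs - ε)) x y ε * (x + y + 2 * xNode Δ tpd tpp c ε + fsD Δ tpd c ε / fsN tpd tpp c ε)) := by
  have e := profile_ratio_two_point hε hTα hP hP' hN hN1 hT hW4 hW4'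
  rw [div_div_div_eq, div_eq_div_iff (mul_ne_zero hv hw') hden]
  linear_combination e

/-- `E = [W4(an)·(u_an + 2x_node + fsD/fsN)] / [W4(node)·(4x_node + fsD/fsN)]` — the node/antinode instance of `profile_ratio_div`'s right side. [folklore] -/
theorem nodalEnhancement_eq_ratio (Δ tpd tpp c a' ya ε : ℝ) :
    nodalEnhancement Δ tpd tpp c a' ya ε =
      (W4 Δ tpd tpp c a' 1 ya ε * (1 + ya + 2 * xNode Δ tpd tpp c ε + fsD Δ tpd c ε / fsN tpd tpp c ε)) /
        (W4 Δ tpd tpp c a' (xNode Δ tpd tpp c ε) (xNode Δ tpd tpp c ε) ε * (4 * xNode Δ tpd tpp c ε + fsD Δ tpd c ε / fsN tpd tpp c ε)) := by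
  unfold nodalEnhancement geomFactor
  rw [div_mul_div_comm]

/-! ## §6 Pointwise domination on the whole Fermi surface and the SLOPE READING (appended 2026-08-30, mod-4 g32; §1–§5 above byte-stable)

When the four-orbital energy denominator does not decrease toward the antinode (`β₄ ≥ 0`, i.e. a non-negative antinodal form defect `δ₄ ≥ 0` — every typed
σ row at the located axial slope), the `v²` form factor scaled to the antinodal weight is a POINTWISE LOWER BOUND of the Cu-4s weight at every Fermi point
(equality at the antinode, ratio rising monotonically to `E` at the node); hence every Fermi-surface average built from `t⊥,max·v²` is a lower estimate of
the first-order four-orbital value. And ONE profile ratio READS the axial slope `a′ = t_sp²/(ε_s − ε_F)²` (a linear equation) — the cell's free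
parameter becomes readable from a bilayer band structure, a c-axis warping profile or projected `s` weights at two Fermi points. -/

/-- On the contour the harmonic `s = x + y − 2xy` is ordered like `u = x + y`: `8fsN·(s(P′) − s(P)) = 4fsT·(u′ − u)` (`fsN1 ≠ 0`). [folklore] -/
theorem harm_sub_harm_eq {Δ tpd tpp c x y x' y' ε : ℝ} (hN1 : fsN1 tpd tpp c ε ≠ 0)
    (hP : charCubic Δ tpd tpp c x y ε = 0) (hP' : charCubic Δ tpd tpp c x' y' ε = 0) :
    8 * fsN tpd tpp c ε * (tpHarm x' y' - tpHarm x y) = 4 * fsT Δ tpd tpp c ε * ((x' + y') - (x + y)) := by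
  have h := harm_sub_node_eq hN1 hP
  have h' := harm_sub_node_eq hN1 hP'
  linear_combination h' - h

/-- **`W4` IS ORDERED LIKE `u` WHEN `β₄ ≥ 0`**: for two contour points with `u ≤ u′`, `fsT > 0`, `fsN > 0`, `0 ≤ β₄(a′)`: `W4(P) ≤ W4(P′)` (`fsT·W4 = α₄ + 8β₄s`).
[folklore] -/
theorem W4_le_W4_of_beta4_nonneg {Δ tpd tpp c x y x' y' ε : ℝ} (a' : ℝ) (hN1 : fsN1 tpd tpp c ε ≠ 0) (hT : 0 < fsT Δ tpd tpp c ε)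
    (hN : 0 < fsN tpd tpp c ε) (hβ : 0 ≤ beta4 Δ tpd tpp c a' ε)
    (hP : charCubic Δ tpd tpp c x y ε = 0) (hP' : charCubic Δ tpd tpp c x' y' ε = 0) (hu : x + y ≤ x' + y') :
    W4 Δ tpd tpp c a' x y ε ≤ W4 Δ tpd tpp c a' x' y' ε := by
  have h := fsT_mul_W4 a' hP
  have h' := fsT_mul_W4 a' hP'
  have hs := harm_sub_harm_eq hN1 hP hP'
  have hds : 0 ≤ tpHarm x' y' - tpHarm x y := by
    have h8 : 0 ≤ 8 * fsN tpd tpp c ε * (tpHarm x' y' - tpHarm x y) := by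
      rw [hs]; exact mul_nonneg (by linarith) (by linarith)
    exact (mul_nonneg_iff_of_pos_left (by linarith : (0:ℝ) < 8 * fsN tpd tpp c ε)).1 h8
  have hdiff : fsT Δ tpd tpp c ε * (W4 Δ tpd tpp c a' x' y' ε - W4 Δ tpd tpp c a' x y ε) =
      8 * beta4 Δ tpd tpp c a' ε * (tpHarm x' y' - tpHarm x y) := by linear_combination h' - h
  have hnn : 0 ≤ fsT Δ tpd tpp c ε * (W4 Δ tpd tpp c a' x' y' ε - W4 Δ tpd tpp c a' x y ε) := by
    rw [hdiff]; exact mul_nonneg (by linarith) hds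
  have := (mul_nonneg_iff_of_pos_left hT).1 hnn
  linarith

/-- `1 ≤ (W′g′)/(Wg)` for `0 < W ≤ W′`, `0 < g ≤ g′`. [folklore] -/
theorem one_le_ratio_of_le {W W' g g' : ℝ} (hW : 0 < W) (hWW : W ≤ W') (hg : 0 < g) (hgg : g ≤ g') : 1 ≤ W' * g' / (W * g) := by
  rw [le_div_iff₀ (mul_pos hW hg), one_mul]
  exact mul_le_mul hWW hgg hg.le (by linarith)

/-- **THE `v²` FORM FACTOR UNDER-WEIGHTS EVERY FERMI POINT** (fixed-Fermi-surface coordinates; `β₄(a′) ≥ 0`, cuprate regime `fsT, fsN, fsD > 0`, `x_node ≥ 0`;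
`P = (x, y)` any Fermi point off the node below the antinodal reference `P′ = (x′, y′)` in `u`, positive denominators): 
`(w_s(P)/v²(P)) / (w_s(P′)/v²(P′)) ≥ 1` — scaled to agree at `P′`, the `(cos k_x − cos k_y)²` profile is a pointwise LOWER bound of the Cu-4s weight,
with equality at `P′` and the ratio rising toward the node. [folklore] -/
theorem one_le_profile_ratio {Δ εs tpd tpp c α T x y x' y' ε : ℝ} (hε : εs - ε ≠ 0) (hTα : T = α * (εs - ε))
    (hP : charCubic Δ tpd tpp c x y ε = 0) (hP' : charCubic Δ tpd tpp c x' y' ε = 0)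
    (hN : 0 < fsN tpd tpp c ε) (hD : 0 < fsD Δ tpd c ε) (hN1 : fsN1 tpd tpp c ε ≠ 0) (hT : 0 < fsT Δ tpd tpp c ε)
    (hxn : 0 ≤ xNode Δ tpd tpp c ε) (hun : 2 * xNode Δ tpd tpp c ε ≤ x + y) (hu : x + y ≤ x' + y')
    (hβ : 0 ≤ beta4 Δ tpd tpp c (α / (εs - ε)) ε) (hW4 : 0 < W4 Δ tpd tpp c (α / (εs - ε)) x y ε)
    (hv : (x - y) ^ 2 ≠ 0) (hw' : sWeight4 Δ εs tpd (tpp - α) (c - α) T x' y' ε ≠ 0) :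
    1 ≤ (sWeight4 Δ εs tpd (tpp - α) (c - α) T x y ε / (x - y) ^ 2) /
      (sWeight4 Δ εs tpd (tpp - α) (c - α) T x' y' ε / (x' - y') ^ 2) := by
  have hg : 0 < x + y + 2 * xNode Δ tpd tpp c ε + fsD Δ tpd c ε / fsN tpd tpp c ε := vsq_factor_pos hN hD hxn hun
  have hWle := W4_le_W4_of_beta4_nonneg (α / (εs - ε)) hN1 hT hN hβ hP hP' hu
  have hW4' : W4 Δ tpd tpp c (α / (εs - ε)) x' y' ε ≠ 0 := by
    intro h0; rw [h0] at hWle; linarith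
  rw [profile_ratio_div hε hTα hP hP' hN.ne' hN1 hT.ne' hW4.ne' hW4' hv hw' (mul_ne_zero hW4.ne' hg.ne')]
  exact one_le_ratio_of_le hW4 hWle hg (by linarith)

/-- **THE SLOPE READING**: with `R := (w_s(P)/v²(P)) / (w_s(P′)/v²(P′))` the ratio of the `v²`-normalised Cu-4s weights (equivalently, at first order, of the
`v²`-normalised c-axis / bilayer splittings) at two Fermi points, the axial slope satisfies the LINEAR equation
`a′·(R·axialLin(P)·g(P) − axialLin(P′)·g(P′)) = ∂_εcharCubic(P′)·g(P′) − R·∂_εcharCubic(P)·g(P)`, `g = u + 2x_node + fsD/fsN` (hypotheses of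
`profile_ratio_div`). [folklore] -/
theorem axialSlope_linear_of_profile_ratio {Δ εs tpd tpp c α T x y x' y' ε : ℝ} (hε : εs - ε ≠ 0) (hTα : T = α * (εs - ε))
    (hP : charCubic Δ tpd tpp c x y ε = 0) (hP' : charCubic Δ tpd tpp c x' y' ε = 0)
    (hN : fsN tpd tpp c ε ≠ 0) (hN1 : fsN1 tpd tpp c ε ≠ 0) (hT : fsT Δ tpd tpp c ε ≠ 0)
    (hW4 : W4 Δ tpd tpp c (α / (εs - ε)) x y ε ≠ 0) (hW4' : W4 Δ tpd tpp c (α / (εs - ε)) x' y' ε ≠ 0)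
    (hv : (x - y) ^ 2 ≠ 0) (hw' : sWeight4 Δ εs tpd (tpp - α) (c - α) T x' y' ε ≠ 0)
    (hg : x + y + 2 * xNode Δ tpd tpp c ε + fsD Δ tpd c ε / fsN tpd tpp c ε ≠ 0) :
    (α / (εs - ε)) * ((sWeight4 Δ εs tpd (tpp - α) (c - α) T x y ε / (x - y) ^ 2) /
          (sWeight4 Δ εs tpd (tpp - α) (c - α) T x' y' ε / (x' - y') ^ 2) *
        axialLin Δ tpd tpp c x y ε * (x + y + 2 * xNode Δ tpd tpp c ε + fsD Δ tpd c ε / fsN tpd tpp c ε)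
        - axialLin Δ tpd tpp c x' y' ε * (x' + y' + 2 * xNode Δ tpd tpp c ε + fsD Δ tpd c ε / fsN tpd tpp c ε)) =
      dcharCubic Δ tpd tpp c x' y' ε * (x' + y' + 2 * xNode Δ tpd tpp c ε + fsD Δ tpd c ε / fsN tpd tpp c ε)
        - (sWeight4 Δ εs tpd (tpp - α) (c - α) T x y ε / (x - y) ^ 2) /
          (sWeight4 Δ εs tpd (tpp - α) (c - α) T x' y' ε / (x' - y') ^ 2) *
        dcharCubic Δ tpd tpp c x y ε * (x + y + 2 * xNode Δ tpd tpp c ε + fsD Δ tpd c ε / fsN tpd tpp c ε) := by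
  have hR := profile_ratio_div hε hTα hP hP' hN hN1 hT hW4 hW4' hv hw' (mul_ne_zero hW4 hg)
  set R := (sWeight4 Δ εs tpd (tpp - α) (c - α) T x y ε / (x - y) ^ 2) /
      (sWeight4 Δ εs tpd (tpp - α) (c - α) T x' y' ε / (x' - y') ^ 2) with hRdef
  have hRW : R * (W4 Δ tpd tpp c (α / (εs - ε)) x y ε * (x + y + 2 * xNode Δ tpd tpp c ε + fsD Δ tpd c ε / fsN tpd tpp c ε)) =
      W4 Δ tpd tpp c (α / (εs - ε)) x' y' ε * (x' + y' + 2 * xNode Δ tpd tpp c ε + fsD Δ tpd c ε / fsN tpd tpp c ε) := by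
    rw [hR]; exact div_mul_cancel₀ _ (mul_ne_zero hW4 hg)
  unfold W4 at hRW
  linear_combination hRW

/-- **… AND IS READ UNIQUELY** when the bracket is non-zero:
`a′ = [∂_εcharCubic(P′)g(P′) − R·∂_εcharCubic(P)g(P)] / [R·axialLin(P)g(P) − axialLin(P′)g(P′)]`. [folklore] -/
theorem axialSlope_eq_of_profile_ratio {Δ εs tpd tpp c α T x y x' y' ε : ℝ} (hε : εs - ε ≠ 0) (hTα : T = α * (εs - ε))
    (hP : charCubic Δ tpd tpp c x y ε = 0) (hP' : charCubic Δ tpd tpp c x' y' ε = 0)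
    (hN : fsN tpd tpp c ε ≠ 0) (hN1 : fsN1 tpd tpp c ε ≠ 0) (hT : fsT Δ tpd tpp c ε ≠ 0)
    (hW4 : W4 Δ tpd tpp c (α / (εs - ε)) x y ε ≠ 0) (hW4' : W4 Δ tpd tpp c (α / (εs - ε)) x' y' ε ≠ 0)
    (hv : (x - y) ^ 2 ≠ 0) (hw' : sWeight4 Δ εs tpd (tpp - α) (c - α) T x' y' ε ≠ 0)
    (hg : x + y + 2 * xNode Δ tpd tpp c ε + fsD Δ tpd c ε / fsN tpd tpp c ε ≠ 0)
    (hbr : (sWeight4 Δ εs tpd (tpp - α) (c - α) T x y ε / (x - y) ^ 2) /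
          (sWeight4 Δ εs tpd (tpp - α) (c - α) T x' y' ε / (x' - y') ^ 2) *
        axialLin Δ tpd tpp c x y ε * (x + y + 2 * xNode Δ tpd tpp c ε + fsD Δ tpd c ε / fsN tpd tpp c ε)
        - axialLin Δ tpd tpp c x' y' ε * (x' + y' + 2 * xNode Δ tpd tpp c ε + fsD Δ tpd c ε / fsN tpd tpp c ε) ≠ 0) :
    α / (εs - ε) =
      (dcharCubic Δ tpd tpp c x' y' ε * (x' + y' + 2 * xNode Δ tpd tpp c ε + fsD Δ tpd c ε / fsN tpd tpp c ε)
        - (sWeight4 Δ εs tpd (tpp - α) (c - α) T x y ε / (x - y) ^ 2) /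
          (sWeight4 Δ εs tpd (tpp - α) (c - α) T x' y' ε / (x' - y') ^ 2) *
        dcharCubic Δ tpd tpp c x y ε * (x + y + 2 * xNode Δ tpd tpp c ε + fsD Δ tpd c ε / fsN tpd tpp c ε)) /
      ((sWeight4 Δ εs tpd (tpp - α) (c - α) T x y ε / (x - y) ^ 2) /
          (sWeight4 Δ εs tpd (tpp - α) (c - α) T x' y' ε / (x' - y') ^ 2) *
        axialLin Δ tpd tpp c x y ε * (x + y + 2 * xNode Δ tpd tpp c ε + fsD Δ tpd c ε / fsN tpd tpp c ε)
        - axialLin Δ tpd tpp c x' y' ε * (x' + y' + 2 * xNode Δ tpd tpp c ε + fsD Δ tpd c ε / fsN tpd tpp c ε)) := by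
  rw [eq_div_iff hbr]
  exact axialSlope_linear_of_profile_ratio hε hTα hP hP' hN hN1 hT hW4 hW4' hv hw' hg

end Summit.Ventures.CertifiedManyBodySolver.Downfold.Emery
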